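import Mathlib
import Literature.NumberTheory.LFunctions.Zhang2022.Section15CEq1522OfContour
import Literature.NumberTheory.LFunctions.Zhang2022.AppendixBLineToCircleGeneric
import Literature.NumberTheory.LFunctions.Zhang2022.AppendixBLineShiftGeneric
import Literature.NumberTheory.LFunctions.Zhang2022.AppendixBLemma151LineShift
import Literature.NumberTheory.LFunctions.Zhang2022.AppendixBTailB3Residue
import Literature.NumberTheory.LFunctions.Zhang2022.AppendixBLemma151Mu1Edge
import HarnessLib

/-!
# Zhang (2022) §15 (15.22): the leaf `h15_22` HOLDS in the reading of record —
# `Typed.Section15C.Eq15_22E e1ppD c′ inputs15ABchi` for every `c′`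

Topic `Literature/NumberTheory/LFunctions/Zhang2022` (Landau–Siegel audit tree; verdict-neutral).
Y. Zhang, *Discrete mean estimates and the Landau–Siegel zero*, arXiv:2211.02515v1 (2022)
[Zhang2022LandauSiegel] — **an unrefereed manuscript under adjudication; nothing here asserts or denies
its Theorems 1–2.** ZHANG-L discharge lane (WP15), leaf `h15_22` [Z22 §15 p. 87, (15.22), tex L4306]:
the skeleton binder (v27 on, RT-05 / R-28) is
`h15_22 : ∀ c' ≥ c₁, Typed.Section15C.Eq15_22E e1ppD c' Typed.Section15C.inputs15ABchi` — (15.22) with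
`b := χ·b` (`inputs15ABchi`, D-G-L4t1-1) and `𝔢ⱼ := frakeE e1ppD j`, the constants `e″₁ⱼ` taken at the value
App. B actually DERIVES (`e1ppD`; the stated closed form `e1ppj` is refuted as printed, `Numerics.not_StepB_u015c`,
`Numerics.not_eqB_3R`).

PROOF. `Section15CEq1522OfContour.eq15_22D_of_contour_legs` reduced the leaf to the three Appendix-B
line-to-circle bounds (μ = 2, 3, 1) and `Z22:§B.u015` 2nd line. All four are now theorems:
* μ = 2: `Skeleton.stepB_u009rR_holds` (zl-w15-p3, `AppendixBLemma151LineShift`);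
* μ = 3, μ = 1: the GENERIC line-to-circle bound `Typed.AppendixB.vline_sub_circle_le_of_shift`
  (zl-libA-p6, `AppendixBLineToCircleGeneric`: shift `Re s = 1 → Re s = 1/log(P_μ/l₁)`, box inside the
  classical zero-free region, tails/sides `O(1/log P_μ)`, rectangle = circle `rect_eq_circle_gen_of_le`) fed
  with the vertical-line shift `Typed.AppendixB.vline_shift_zetaRatio_kerB` / `integrable_zetaRatio_kerB_line`
  (zl-closer-4, `AppendixBLineShiftGeneric`), INSTANTIATED here at `(P₃, β₆)` and `(P₁, β₆)`:
  privately — `lineToCircle_h9r_of_generic` (eventual side conditions ⇒ the `h9r` shape at rate `α₁`),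
  instances `lineToCircle_P3_beta6`, `lineToCircle_P1_beta6`, legs `stepB_mu3R_inst`, `stepB_u012R_inst`
  (all PRIVATE so as not to duplicate the citable instances / leg closers of zl-libA-p6's
  `AppendixBLineToCircle.lean`, the route of record W15-R8/R10, landing in parallel; side conditions: `1 < P_μ`,
  `log P_μ ∈ {0.498, 0.504}·𝓛⁹ ≥ 𝓛⁹/4`, `T ≤ P_μ/l₁` for `l₁ < T` since `2𝓛^{1.1} ≤ 𝓛⁹/4`, `β₆ = 3iα/2 ≠ 0, β_j`,
  `Re β₆ = 0`, `‖β₆‖ ≤ 3α` — `Skeleton.beta6_size`);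
* (B.u015): `AppendixBVarrho.stepB_u015bR_holds` (zl-w15-p8, `AppendixBTailB3Residue`).

Main results (the citable by-name leg closers `stepB_mu3R_holds` / `stepB_u012R_holds` and the citable
`(P₃,β₆)`/`(P₁,β₆)` instances are left to the leg owners' `AppendixBLineToCircle.lean`; here they are private):
* **`Skeleton.lemma151ChiRE_e1ppD_holds : ∀ c′, Lemma151ChiRE e1ppD c′`** — Lemma 15.1 (χ-reading, derived
  constants), the by-name input of the §16/§17 E-chains (WP15-PLAN W15-R10 / W16-S5e (C′));
* **`Typed.Section15C.eq15_22E_e1ppD_holds : ∀ c′, Eq15_22E e1ppD c′ inputs15ABchi`** (accepted closer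
  shape `∀ c'`; plugs the v27+ binder as `fun c' _ => eq15_22E_e1ppD_holds c'`), and the threshold form
  `Typed.Section15C.eq15_22E_e1ppD_of_le`.

WHAT THIS IS NOT: the printed-constant leaf `Eq15_22 c′ inputs15ABchi` (= `Eq15_22E e1ppj`, whose (B.3)
input is refuted as printed), nor any claim about Theorems 1–2 of the manuscript or Landau–Siegel zeros.
Honest framing: a kernel theorem about a typed-as-printed display of an unrefereed manuscript at the
repaired-of-record constants (RETYPE-LEDGER RT-05).

## References
* Y. Zhang, arXiv:2211.02515v1 (2022), §15 (15.22) p. 87; Lemma 15.1 p. 86; App. B pp. 106–108.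
  [cite: Zhang2022LandauSiegel, §15 (15.22) p.87; App. B p.107]
-/

noncomputable section

open Complex Real

namespace Literature.NumberTheory.LFunctions.Zhang2022.Skeleton

open Typed.AppendixB (zetaRatio kerB vline vkSum)

section LineToCircleInstances

variable (c' : ℝ)

/-- `L₀ ≤ log D` once `D ≥ ⌈exp L₀⌉₊`. [folklore] -/
private theorem le_ell_of_ceil_exp_le_h1522 {L₀ : ℝ} {D : ℕ} (hD : ⌈Real.exp L₀⌉₊ ≤ D) :
    L₀ ≤ ell D := by
  have h : Real.exp L₀ ≤ D := le_trans (Nat.le_ceil _) (by exact_mod_cast hD)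
  exact (Real.le_log_iff_exp_le (lt_of_lt_of_le (Real.exp_pos _) h)).mpr h

/-- `2𝓛^{1.1} ≤ 𝓛⁹/4` for `𝓛 ≥ 2`. [folklore] -/
private theorem two_ell_11_le {D : ℕ} (hℓ : 2 ≤ ell D) :
    2 * ell D ^ (1.1 : ℝ) ≤ ell D ^ 9 / 4 := by
  have hℓ1 : 1 ≤ ell D := by linarith
  have hℓ0 : 0 < ell D := by linarith
  have h11 : ell D ^ (1.1 : ℝ) ≤ ell D ^ 2 := by
    calc ell D ^ (1.1 : ℝ) ≤ ell D ^ (2 : ℝ) := Real.rpow_le_rpow_of_exponent_le hℓ1 (by norm_num)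
      _ = ell D ^ 2 := by norm_cast
  have hℓ7 : (128 : ℝ) ≤ ell D ^ 7 := by
    calc (128 : ℝ) = 2 ^ 7 := by norm_num
      _ ≤ ell D ^ 7 := by gcongr
  have hℓ9 : 8 * ell D ^ 2 ≤ ell D ^ 9 := by
    have : ell D ^ 9 = ell D ^ 2 * ell D ^ 7 := by ring
    rw [this]; nlinarith [pow_pos hℓ0 2]
  linarith

/-- `T ≤ P_μ/l₁` for `1 ≤ l₁ < T` once `log P_μ ≥ 𝓛⁹/4` and `𝓛 ≥ 2` (`T² = e^{2𝓛^{1.1}} ≤ e^{𝓛⁹/4} ≤ P_μ`).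
[cite: Zhang2022LandauSiegel, §2 (2.21)] -/
private theorem bigT_le_div {D : ℕ} (hℓ : 2 ≤ ell D) {Pμ : ℝ} (hPμ : 1 < Pμ)
    (hlog : ell D ^ 9 / 4 ≤ Real.log Pμ) {l₁ : ℕ} (hl₁ : 1 ≤ l₁) (hT : (l₁ : ℝ) < bigT D) :
    bigT D ≤ Pμ / l₁ := by
  have hP0 : 0 < Pμ := by linarith
  have hl0 : (0 : ℝ) < l₁ := by exact_mod_cast hl₁
  have hT0 : 0 < bigT D := Real.exp_pos _
  have hTT : bigT D * bigT D ≤ Pμ := by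
    have h1 : bigT D * bigT D = Real.exp (2 * ell D ^ (1.1 : ℝ)) := by
      rw [bigT, ← Real.exp_add]; ring_nf
    rw [h1]
    calc Real.exp (2 * ell D ^ (1.1 : ℝ)) ≤ Real.exp (Real.log Pμ) :=
          Real.exp_le_exp.mpr (le_trans (two_ell_11_le hℓ) hlog)
      _ = Pμ := Real.exp_log hP0
  rw [le_div_iff₀ hl0]
  calc bigT D * l₁ ≤ bigT D * bigT D := by gcongr
    _ ≤ Pμ := hTT

/-- **From the generic line-to-circle bound to the `h9r` shape** (App. B p. 107, the contour move
"the right side is equal to the sum of the residues … plus an acceptable error", at any parameter family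
`(P_μ(D), β(D))`): if `Typed.AppendixB.vline_sub_circle_le_of_shift`'s conclusion holds and, for `D` large and
`j ∈ {1,2,3}`, `1 < P_μ`, `𝓛⁹/4 ≤ log P_μ`, `β ≠ 0`, `β ≠ β_j`, `Re β = 0`, `‖β‖ ≤ 3α`, then for `D` large,
`j ∈ {1,2,3}`, `1 ≤ l₁ < T`:
`‖(1/2πi)∫_{(1)} F − (2πi)⁻¹∮_{|s|=5α} F‖ ≤ C·α₁` (`F = zetaRatio·kerB P_μ β l₁`; `α ≤ α₁`).
[cite: Zhang2022LandauSiegel, App. B p.107] -/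
private theorem lineToCircle_h9r_of_generic (Pf : ℕ → ℝ) (βf : ℕ → ℂ)
    (hgen : ∃ C : ℝ, ∃ D₀ : ℕ, ∀ D : ℕ, D₀ ≤ D → ∀ j ∈ ({1, 2, 3} : Finset ℕ),
      ∀ (Pμ : ℝ) (l₁ : ℕ) (β : ℂ), 1 < Pμ → ell D ^ 9 / 4 ≤ Real.log Pμ → 1 ≤ l₁ →
        bigT D ≤ Pμ / l₁ → β ≠ 0 → β ≠ betaJ c' D j → β.re = 0 → ‖β‖ ≤ 3 * alpha D →
        ‖vline 1 (fun s => zetaRatio c' D j s * kerB Pμ β l₁ s) -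
            (2 * π * I)⁻¹ * (∮ s in C((0 : ℂ), 5 * alpha D), zetaRatio c' D j s * kerB Pμ β l₁ s)‖ ≤
          C * alpha D)
    (hside : ∃ D₁ : ℕ, ∀ D : ℕ, D₁ ≤ D → ∀ j ∈ ({1, 2, 3} : Finset ℕ),
      1 < Pf D ∧ ell D ^ 9 / 4 ≤ Real.log (Pf D) ∧ βf D ≠ 0 ∧ βf D ≠ betaJ c' D j ∧
        (βf D).re = 0 ∧ ‖βf D‖ ≤ 3 * alpha D) :
    ∃ C : ℝ, ForAllLarge fun D _ _ => ∀ j ∈ ({1, 2, 3} : Finset ℕ), ∀ l₁ : ℕ, 1 ≤ l₁ →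
      l₁ ∈ nset (frakq D) → (l₁ : ℝ) < bigT D →
        ‖vline 1 (fun s => zetaRatio c' D j s * kerB (Pf D) (βf D) l₁ s) -
            (2 * π * I)⁻¹ * (∮ s in C((0 : ℂ), 5 * alpha D),
              zetaRatio c' D j s * kerB (Pf D) (βf D) l₁ s)‖ ≤ C * alpha1 D := by
  obtain ⟨C, D₀, h⟩ := hgen
  obtain ⟨D₁, hs⟩ := hside
  refine ⟨max C 0, max D₀ (max D₁ (max 3 ⌈Real.exp 2⌉₊)), fun D _ χ hD _ _ j hj l₁ hl₁ _ hT => ?_⟩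
  have hD₀ : D₀ ≤ D := le_trans (le_max_left _ _) hD
  have hD₁ : D₁ ≤ D := le_trans (le_max_left _ _) (le_trans (le_max_right _ _) hD)
  have hD3 : 3 ≤ D :=
    le_trans (le_max_left _ _) (le_trans (le_max_right _ _) (le_trans (le_max_right _ _) hD))
  have hℓ2 : 2 ≤ ell D :=
    le_ell_of_ceil_exp_le_h1522
      (le_trans (le_max_right _ _) (le_trans (le_max_right _ _) (le_trans (le_max_right _ _) hD)))
  obtain ⟨hP, hlog, hβ0, hβb, hβre, hβ3⟩ := hs D hD₁ j hj
  have a := h D hD₀ j hj (Pf D) l₁ (βf D) hP hlog hl₁ (bigT_le_div hℓ2 hP hlog hl₁ hT) hβ0 hβb hβre hβ3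
  -- `α ≤ α₁`
  have hD3' : (3 : ℝ) ≤ D := by exact_mod_cast hD3
  have hℓ1 : 1 ≤ ell D := by linarith
  have hα0 : 0 ≤ alpha D := (alpha_pos hD3).le
  have hαα1 : alpha D ≤ alpha1 D := by
    rw [alpha1, log_bigT]
    have : (1 : ℝ) ≤ ell D ^ (1.1 : ℝ) := Real.one_le_rpow hℓ1 (by norm_num)
    nlinarith
  calc _ ≤ C * alpha D := a
    _ ≤ max C 0 * alpha D := mul_le_mul_of_nonneg_right (le_max_left _ _) hα0
    _ ≤ max C 0 * alpha1 D := mul_le_mul_of_nonneg_left hαα1 (le_max_right _ _)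

/-- The generic line-to-circle bound of the tree, assembled: `vline_sub_circle_le_of_shift` fed with the
vertical-line shift and integrability of `AppendixBLineShiftGeneric`. [cite: Zhang2022LandauSiegel, App. B p.107] -/
private theorem lineToCircle_generic :
    ∃ C : ℝ, ∃ D₀ : ℕ, ∀ D : ℕ, D₀ ≤ D → ∀ j ∈ ({1, 2, 3} : Finset ℕ),
      ∀ (Pμ : ℝ) (l₁ : ℕ) (β : ℂ), 1 < Pμ → ell D ^ 9 / 4 ≤ Real.log Pμ → 1 ≤ l₁ →
        bigT D ≤ Pμ / l₁ → β ≠ 0 → β ≠ betaJ c' D j → β.re = 0 → ‖β‖ ≤ 3 * alpha D →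
        ‖vline 1 (fun s => zetaRatio c' D j s * kerB Pμ β l₁ s) -
            (2 * π * I)⁻¹ * (∮ s in C((0 : ℂ), 5 * alpha D), zetaRatio c' D j s * kerB Pμ β l₁ s)‖ ≤
          C * alpha D :=
  Typed.AppendixB.vline_sub_circle_le_of_shift c'
    (fun hP hl hβ hσ => Typed.AppendixB.integrable_zetaRatio_kerB_line c' hP hl hβ hσ)
    (fun hP hl hβ hε hε1 => Typed.AppendixB.vline_shift_zetaRatio_kerB c' hP hl hβ hε hε1)

/-- The side conditions at `β = β₆ = 3iα/2` and `P_μ = P^θ` (`θ ∈ {0.498, 0.504}`), for `D` large: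
`1 < P^θ`, `log P^θ = θ𝓛⁹ ≥ 𝓛⁹/4` (`θ ≥ 1/4`), `β₆ ≠ 0`, `β₆ ≠ β_j`, `Re β₆ = 0`, `‖β₆‖ = 3α/2 ≤ 3α`.
[cite: Zhang2022LandauSiegel, §2 (2.21), (2.22)] -/
private theorem side_beta6 {θ : ℝ} (hθ : 1 / 4 ≤ θ) :
    ∃ D₁ : ℕ, ∀ D : ℕ, D₁ ≤ D → ∀ j ∈ ({1, 2, 3} : Finset ℕ),
      1 < bigP D ^ θ ∧ ell D ^ 9 / 4 ≤ Real.log (bigP D ^ θ) ∧ beta6 D ≠ 0 ∧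
        beta6 D ≠ betaJ c' D j ∧ (beta6 D).re = 0 ∧ ‖beta6 D‖ ≤ 3 * alpha D := by
  refine ⟨max 3 ⌈Real.exp (max (max 2 (60 * |c'| * π)) (max (10 * π / 1) (8 * 0 * π)))⌉₊,
    fun D hD j hj => ?_⟩
  have hD3 : 3 ≤ D := le_trans (le_max_left _ _) hD
  obtain ⟨hℓ2, hc, -, -, hα0, -, -⟩ := large_package c' zero_lt_one le_rfl
    (le_ell_of_ceil_exp_le_h1522 (le_trans (le_max_right _ _) hD))
  obtain ⟨h6b, hn6⟩ := beta6_size c' hℓ2 hc hj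
  have hℓ0 : 0 < ell D := by linarith
  have hθ0 : 0 < θ := by linarith
  have hP1 : 1 < bigP D := by
    rw [bigP]; exact Real.one_lt_exp_iff.mpr (pow_pos hℓ0 9)
  have hP0 : 0 < bigP D := Real.exp_pos _
  refine ⟨Real.one_lt_rpow hP1 hθ0, ?_, ?_, ?_, by simp [beta6], ?_⟩
  · rw [Real.log_rpow hP0, bigP, Real.log_exp]
    have : 0 ≤ ell D ^ 9 := (pow_pos hℓ0 9).le
    nlinarith
  · intro h; rw [h, norm_zero] at hn6; linarith
  · intro h; rw [h, sub_self, norm_zero] at h6b; linarith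
  · rw [hn6]; linarith

/-- **The `μ = 3` line-to-circle bound** (App. B p. 107, "In case `μ = 3` the proof can be obtained with
`β₆` and `P₃` in place of `β₇` and `P₂`"; reading `α₁ = α log T`): for `D` large, `j ∈ {1,2,3}`,
`1 ≤ l₁ < T`,
`‖(1/2πi)∫_{(1)} ζ(1+s)/ζ(1+s−β_j)·(P₃/l₁)ˢ/((log P₃)(s−β₆)²) ds − (2πi)⁻¹∮_{|s|=5α} (same)‖ ≤ C·α₁` —
the hypothesis `h9r` of `Skeleton.stepB_mu3R_of_perron_shift` VERBATIM, an instance of the generic bound.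
[cite: Zhang2022LandauSiegel, App. B p.107] -/
private theorem lineToCircle_P3_beta6 : ∃ C : ℝ, ForAllLarge fun D _ _ =>
    ∀ j ∈ ({1, 2, 3} : Finset ℕ), ∀ l₁ : ℕ, 1 ≤ l₁ → l₁ ∈ nset (frakq D) → (l₁ : ℝ) < bigT D →
      ‖vline 1 (fun s => zetaRatio c' D j s * kerB (P3 D) (beta6 D) l₁ s) -
          (2 * π * I)⁻¹ * (∮ s in C((0 : ℂ), 5 * alpha D),
            zetaRatio c' D j s * kerB (P3 D) (beta6 D) l₁ s)‖ ≤ C * alpha1 D :=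
  lineToCircle_h9r_of_generic c' P3 beta6 (lineToCircle_generic c')
    (side_beta6 c' (θ := 0.498) (by norm_num))

/-- **The `μ = 1` line-to-circle bound** (App. B p. 107, "The same argument also gives
`Σ_l ϰ₁(l₁l)ϱ_j(l)/l = e′_{1j} + O(α₁)`", with `P₁, β₆`): for `D` large, `j ∈ {1,2,3}`, `1 ≤ l₁ < T`,
`‖(1/2πi)∫_{(1)} ζ(1+s)/ζ(1+s−β_j)·(P₁/l₁)ˢ/((log P₁)(s−β₆)²) ds − (2πi)⁻¹∮_{|s|=5α} (same)‖ ≤ C·α₁` —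
the hypothesis `h9r` of `Skeleton.stepB_u012R_of` VERBATIM. [cite: Zhang2022LandauSiegel, App. B p.107] -/
private theorem lineToCircle_P1_beta6 : ∃ C : ℝ, ForAllLarge fun D _ _ =>
    ∀ j ∈ ({1, 2, 3} : Finset ℕ), ∀ l₁ : ℕ, 1 ≤ l₁ → l₁ ∈ nset (frakq D) → (l₁ : ℝ) < bigT D →
      ‖vline 1 (fun s => zetaRatio c' D j s * kerB (P1 D) (beta6 D) l₁ s) -
          (2 * π * I)⁻¹ * (∮ s in C((0 : ℂ), 5 * alpha D),
            zetaRatio c' D j s * kerB (P1 D) (beta6 D) l₁ s)‖ ≤ C * alpha1 D :=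
  lineToCircle_h9r_of_generic c' P1 beta6 (lineToCircle_generic c')
    (side_beta6 c' (θ := 0.504) (by norm_num))

/-- The `μ = 3` leg `StepB_mu3R c′` (private instance; the citable by-name closer `stepB_mu3R_holds` is
zl-libA-p6's / zl-closer-4's, `AppendixBLineToCircle.lean`): `stepB_mu3R_of_perron_shift` at the Perron
identity `vkSum_vk3_eq_vline` and `lineToCircle_P3_beta6`. [cite: Zhang2022LandauSiegel, App. B p.107] -/
private theorem stepB_mu3R_inst : Typed.AppendixB.StepB_mu3R c' :=
  stepB_mu3R_of_perron_shift c' (vkSum_vk3_eq_vline c') (lineToCircle_P3_beta6 c')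

/-- The `μ = 1` leg `StepB_u012R c′` (private instance; the citable by-name closer `stepB_u012R_holds` is
zl-w09-p5's / zl-libA-p6's): `stepB_u012R_of_lineToCircle` at `lineToCircle_P1_beta6`.
[cite: Zhang2022LandauSiegel, App. B p.107] -/
private theorem stepB_u012R_inst : Typed.AppendixB.StepB_u012R c' :=
  stepB_u012R_of_lineToCircle c' (lineToCircle_P1_beta6 c')

/-- **Lemma 15.1 in the χ-reading at the DERIVED Appendix-B constants holds for every `c′`:
`Skeleton.Lemma151ChiRE e1ppD c′`** — `Σ_n b(l₁n)ρⱼ(n)/n = 𝔢ⱼᴱ·χ(l₁)… + O(α₁)` with `e″₁ⱼ := e1ppD`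
(App. B pp. 106–108; RT-05 / R-28). All five Appendix-B inputs of `lemma151ChiRE_e1ppD_of_appB_legs` are
theorems: `μ = 2` (`stepB_mu2R_of_u009rR ∘ stepB_u009rR_holds`), `μ = 3`, `μ = 1` (the generic line-to-circle
bound instantiated, this file), (B.1)/(B.2)/`u015aR` (inside the edge) and `u015bR` (`stepB_u015bR_holds`).
This is the by-name input of the §16/§17 E-chains (`eq16_15E_of_lemma151ChiRE`, the §17 E-port) as well as
of (15.22)ᴱ. [cite: Zhang2022LandauSiegel, §15 Lemma 15.1 p.86; App. B pp.106–108] -/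
theorem lemma151ChiRE_e1ppD_holds : Lemma151ChiRE e1ppD c' :=
  lemma151ChiRE_e1ppD_of_appB_legs c' (stepB_mu2R_of_u009rR c' (stepB_u009rR_holds c'))
    (stepB_mu3R_inst c') (stepB_u012R_inst c') (AppendixBVarrho.stepB_u015bR_holds c')

end LineToCircleInstances

end Literature.NumberTheory.LFunctions.Zhang2022.Skeleton

namespace Literature.NumberTheory.LFunctions.Zhang2022.Typed.Section15C

open Literature.NumberTheory.LFunctions.Zhang2022.Skeleton

section Closer

/-- **Leaf `h15_22` in the reading of record: (15.22)ᴱ at the derived constants holds for every `c′`** —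
`Σ_{n<T, n∈𝒩₁, (n,𝔮)=1} b(n)𝒟₁(n,ψ)/n = 𝔢ⱼ·𝓜₁(1,1;1−βⱼ)·Σ' + O(1/𝓛)` with `b := χ·b` and
`𝔢ⱼ := frakeE e1ppD j` (§15 p. 87 (15.22); RT-05 / R-28): `eq15_22E_of_lemma151ChiRE` (the §15-side
deduction «By (15.19)–(15.21) and Lemma 15.1», Rankin cut and smooth majorant: theorems) at
`Skeleton.lemma151ChiRE_e1ppD_holds`; equivalently `eq15_22D_of_contour_legs` at the three line-to-circle
theorems and `stepB_u015bR_holds`. [cite: Zhang2022LandauSiegel, §15 (15.22) p.87] -/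
theorem eq15_22E_e1ppD_holds (c' : ℝ) : Eq15_22E e1ppD c' inputs15ABchi :=
  eq15_22E_of_lemma151ChiRE c' e1ppD (lemma151ChiRE_e1ppD_holds c')

/-- Threshold form of `eq15_22E_e1ppD_holds` (the v27+ skeleton binder shape
`∀ c' ≥ c₁, Eq15_22E e1ppD c' inputs15ABchi`, any `c₁`). [cite: Zhang2022LandauSiegel, §15 (15.22) p.87] -/
theorem eq15_22E_e1ppD_of_le (c₁ c' : ℝ) (_h : c₁ ≤ c') : Eq15_22E e1ppD c' inputs15ABchi :=
  eq15_22E_e1ppD_holds c'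

end Closer

end Literature.NumberTheory.LFunctions.Zhang2022.Typed.Section15C
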